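import Mathlib
import Literature.Probability.LatticeModels.IsoradialPercolation
import Literature.Probability.Percolation.Percolation
import HarnessLib

/-!
# Crux `NoHeavyLowerTail` (stmt-CriticalPhenomena-4575), line `one-cut-entropy-shearer` — definitions

Vocabulary for the NO-GO theorem of `Theorems/PercNearOneGluingNoHeavyLowerTailIndicatorLawNoGo.lean`
(route-task nh7-entropy, 2026-08-18).  The crux
`Summit.CriticalPhenomena.PercolationContinuityZ3.Theses.PercNearOneGluing.NoHeavyLowerTail` (≡ Kozma–Nitzan
Conjecture 3, shared with the sibling route `PercNearOneGluingNoHeavy`) is a statement about the law of the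
random set `S = {a ∈ A : o ↔ a}` of relays joined to the observer.  The "entropy / Shearer over pair
marginals" line asks whether the bad lower-tail mass `P(1 ≤ |S| < ρ·E|S|)` can be bounded using only

* the joint law of the indicator vector `(1_{o ↔ a})_{a ∈ A}` — any universally valid inequality for laws on
  `{0,1}^A` (Shearer / Han / union bounds / Markov), plus POSITIVE ASSOCIATION of that law (Harris);
* the two scalar hypotheses it sees: `P(S = ∅) ≤ t` and pair discordance `P(1_{o↔a} ≠ 1_{o↔a'}) ≤ t`
  (the only trace of `P(a ↮ a') ≤ t` on the indicator law, since `{o ↔ a, o ↮ a'} ⊆ {a ↮ a'}`).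

`IndicatorLawLowerTail C ρ` is exactly that claim (linear form, as needed for the one-cut engine with constants), and
`IndicatorLawLowerTailED` its ε–δ form (the literal shape of the crux), typed over abstract positively associated laws
(`IsPosAssocLaw`) on the Boolean lattice `Finset ι`.  The companion file proves (i) the principle would imply
the crux and (ii) the principle is FALSE for every `C` and every `ρ > 0`, witnessed by the law `fakeLaw`
(`½ δ_⊤ + ½ Ber(q)^{⊗k}`, built from the product weights `berW`); `relaySet` / `relayLaw` are the
percolation-side objects (the random relay set and its law under `prodBernoulli w`).  Nothing here asserts
anything about the crux.
-/

noncomputable section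

namespace Summit.CriticalPhenomena.PercolationContinuityZ3.Theorems

open Finset MeasureTheory
open Literature.Probability.LatticeModels (prodBernoulli)
open Literature.Probability.Percolation (openConn)
open scoped BigOperators Classical

/-- **Positively associated discrete law (events form).**  A nonnegative weight `p` on the Boolean
lattice `Finset ι` such that any two increasing events `U, V` (up-sets for `⊆`) satisfy
`p(U) · p(V) ≤ p(everything) · p(U ∩ V)` — the shape of Harris' inequality / FKG; for a probability law
`p(everything) = 1`. [folklore] -/
def IsPosAssocLaw {ι : Type} [Fintype ι] (p : Finset ι → ℝ) : Prop :=
  (∀ s, 0 ≤ p s) ∧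
    ∀ U V : Set (Finset ι), IsUpperSet U → IsUpperSet V →
      (∑ s with s ∈ U, p s) * (∑ s with s ∈ V, p s) ≤ (∑ s, p s) * ∑ s with (s ∈ U ∧ s ∈ V), p s

/-- **The abstract indicator-law lower-tail principle** with constants `C, ρ`: for every finite index
type `ι` and every positively associated probability law `p` on `Finset ι` (think: the law of
`S = {a : o ↔ a}`), writing `N = |S|` and `m = Σ_i p(i ∈ S) = E N`: if `p(S = ∅) ≤ t` and every pair of
indices is discordant with probability `p((i ∈ S) ≠ (j ∈ S)) ≤ t`, then `p(1 ≤ N < ρ m) ≤ C t`.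
This is what an entropy/Shearer-type argument over pair marginals of the connection indicators (even
helped by positive association) would have to establish to give the one-cut engine with constants; it is
refuted in the companion file. [this work] -/
def IndicatorLawLowerTail (C ρ : ℝ) : Prop :=
  ∀ (ι : Type) [Fintype ι] [DecidableEq ι] (p : Finset ι → ℝ), IsPosAssocLaw p → ∑ s, p s = 1 →
    ∀ t : ℝ, 0 ≤ t → p ∅ ≤ t →
      (∀ i j : ι, i ≠ j → (∑ s with ((i ∈ s ∧ j ∉ s) ∨ (j ∈ s ∧ i ∉ s)), p s) ≤ t) →
      (∑ s with (1 ≤ s.card ∧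
          (s.card : ℝ) < ρ * ∑ i : ι, ∑ u with i ∈ u, p u), p s) ≤ C * t

/-- Product Bernoulli weights `q^{|s|} (1 - q)^{k - |s|}` on `Finset (Fin k)` (each of the `k` points kept
independently with probability `q`). [folklore] -/
def berW (k : ℕ) (q : ℝ) (s : Finset (Fin k)) : ℝ := q ^ s.card * (1 - q) ^ (k - s.card)

/-- **The fake law** `½ δ_⊤ + ½ Ber(q)^{⊗k}` on `Finset (Fin k)`: the top atom (all indices present, "`o`
glued to everything") with mass `1/2`, plus half of the product Bernoulli law ("`o` sees a sparse
independent sprinkle of the relays").  Log-supermodular, hence positively associated. [this work] -/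
def fakeLaw (k : ℕ) (q : ℝ) (s : Finset (Fin k)) : ℝ :=
  (if s = univ then (1 / 2 : ℝ) else 0) + berW k q s / 2

/-- The random set of relays joined to the observer `o`, as a `Finset` of the subtype `A`:
`relaySet A o ω = {a ∈ A : o ↔ a in ω}`. [this work] -/
def relaySet {n : ℕ} (A : Finset (Fin n)) (o : Fin n) (ω : Set (Sym2 (Fin n))) : Finset A :=
  univ.filter fun a : A => ω ∈ openConn o (a : Fin n)

/-- The law of the relay set under `prodBernoulli w`: `relayLaw w A o s = P(relaySet = s)`. [this work] -/
def relayLaw {n : ℕ} (w : Sym2 (Fin n) → unitInterval) (A : Finset (Fin n)) (o : Fin n) (s : Finset A) : ℝ :=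
  (prodBernoulli w).real (relaySet A o ⁻¹' {s})

/-- **The abstract indicator-law lower-tail principle, ε–δ form** — the exact shape of the crux `NoHeavyLowerTail`
transported to abstract positively associated laws: for every `ε > 0` there is `δ > 0` such that for every finite index type and
every positively associated probability law `p` on `Finset ι` with `p(S = ∅) ≤ δ` and pair discordance `≤ δ`, the bad mass
`p(1 ≤ N ∧ N < δ·m/ε)` is `< ε` (`m = Σ_i p(i ∈ S)`).  Weaker than `IndicatorLawLowerTail C ρ` for any `C, ρ > 0`; also refuted in
the companion file, by the same witness. [this work] -/
def IndicatorLawLowerTailED : Prop :=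
  ∀ ε : ℝ, 0 < ε → ∃ δ : ℝ, 0 < δ ∧
    ∀ (ι : Type) [Fintype ι] [DecidableEq ι] (p : Finset ι → ℝ), IsPosAssocLaw p → ∑ s, p s = 1 →
      p ∅ ≤ δ →
      (∀ i j : ι, i ≠ j → (∑ s with ((i ∈ s ∧ j ∉ s) ∨ (j ∈ s ∧ i ∉ s)), p s) ≤ δ) →
      (∑ s with (1 ≤ s.card ∧
          (s.card : ℝ) < δ * (∑ i : ι, ∑ u with i ∈ u, p u) / ε), p s) < ε

end Summit.CriticalPhenomena.PercolationContinuityZ3.Theorems
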